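import Summits.ABC.ABC.Theses.DefiniteXi
import Summits.ABC.ABC.Theorems.FreyDegreeBound.Negative.LevelAndConductor
import HarnessLib

/-!
# `FreyModularity` (stmt-ABC-11340) — the level and non-degeneracy hypotheses are load-bearing

Negative support for crux stmt-ABC-11340 (`Summit.ABC.ABC.Theses.DefiniteXi.FreyModularity`), written by
the crux disprover (`refuter-cdisprove-stmt-ABC-11340-0`, 2026-08-16, `Cruxes/FreyModularity/Disproof.lean`
findings A2/A3).  The crux reads

  `∀ a b, IsCoprime a b → ab(a+b) ≠ 0 → ∀ N [NeZero N], N_{E_(a,b)} = N →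
     Nonempty (ModularParametrizationData (freyCurve a b) N)`.

Of its three hypotheses, `IsCoprime a b` is NOT load-bearing for truth (the coprime-free version is equally
a consequence of BCDT Thm A — `Disproof.lean` A1); the other two are, for the same junk reasons already
recorded for the sibling crux `FreyDegreeBound` by its disprover
(`Theorems/FreyDegreeBound/Negative/LevelAndConductor.lean`, REUSED here, not re-proved):

* `freyModularity_false_without_level` — with `N_{E_(a,b)} = N` dropped the statement fails at level
  `N = 1`, where no curve carries a datum (`isEmpty_modularParametrizationData_one`: `S₂(Γ₀(1)) = 0` and a
  newform is normalised);
* `freyModularity_false_without_nonzero` — with `ab(a+b) ≠ 0` dropped it fails at `(a,b) = (0,1)`: the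
  singular cubic `y² = x²(x+1)` has the junk conductor `1` (`conductorNorm_of_Δ_eq_zero`), so a datum at
  level `1` would be required.

What this does NOT say: nothing against the crux as filed (a theorem in print: modularity of Frey curves).
-/

-- `Summit.<Summit>.<Problem>`: for the single-conjunct summit `ABC` the duplicate `ABC.ABC` is mandated.
set_option linter.dupNamespace false

noncomputable section

open Literature.NumberTheory.EllipticCurves
open Literature.NumberTheory.EllipticCurves.ModularForms
open Summit.ABC.ABC.Theorems.FreyDegreeBound.Negative

namespace Summit.ABC.ABC.Theorems.FreyModularity.Negative

/-- **`FreyModularity` with the level hypothesis `N_{E_(a,b)} = N` dropped is false**: at `a = b = 1`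
(coprime, `ab(a+b) = 2 ≠ 0`) and level `N = 1` there is no datum
(`FreyDegreeBound.Negative.isEmpty_modularParametrizationData_one`).  A proof of the crux must use
that the level is pinned to the conductor (Carayol's level, where modularity supplies data). [folklore] -/
theorem freyModularity_false_without_level :
    ¬ ∀ a b : ℤ, IsCoprime a b → a * b * (a + b) ≠ 0 → ∀ (N : ℕ) [NeZero N],
        Nonempty (ModularParametrizationData (freyCurve a b) N) := by
  intro h
  obtain ⟨D⟩ := h 1 1 isCoprime_one_left (by norm_num) 1
  exact (isEmpty_modularParametrizationData_one (freyCurve 1 1)).false D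

/-- **`FreyModularity` with the non-degeneracy hypothesis `ab(a+b) ≠ 0` dropped is (junk-)false**:
`E_{0,1}` (`y² = x²(x + 1)`, `Δ = 0`) has `conductorNorm = 1`
(`FreyDegreeBound.Negative.conductorNorm_of_Δ_eq_zero`) and there is no datum at level `1`.
[folklore] -/
theorem freyModularity_false_without_nonzero :
    ¬ ∀ a b : ℤ, IsCoprime a b → ∀ (N : ℕ) [NeZero N],
        (freyCurve a b).conductorNorm ℤ = N →
          Nonempty (ModularParametrizationData (freyCurve a b) N) := by
  intro h
  have hΔ : (freyCurve 0 1).Δ = 0 := by rw [freyCurve_Δ]; simp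
  obtain ⟨D⟩ := h 0 1 isCoprime_one_right 1 (conductorNorm_of_Δ_eq_zero _ hΔ)
  exact (isEmpty_modularParametrizationData_one (freyCurve 0 1)).false D

end Summit.ABC.ABC.Theorems.FreyModularity.Negative

end
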